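import Summits.BirchSwinnertonDyer.Rank1Residual.ManinAdditive.NegOneOptimalTwistRigidityProof
import Literature.NumberTheory.EllipticCurves.QuadraticTwistNegOneMinimalDiscriminant
import HarnessLib

/-!
# THEOREM I from ONE printed input — edges (cell `bsd-f2-manin`, T-an-8): the landed leaves E-an-10
# `MinusOneOrbitManinEq` (p558368) and E-an-8 (ii) `MinusOneTwistRigidity` (p551258) follow from the Literature named
# fact `connellPal_Δ_eq_of_negOne_twist_of_four_dvd_conductor` (Pal 2012 Prop. 2.4 (Connell 5.7.3), global corollary
# at `d = −1`, `QuadraticTwistNegOneMinimalDiscriminant.lean`)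

The planner's kernel-checked reductions `minusOneOrbitManinEq_of_pal`, `minusOneTwistRigidity_of_pal`,
`negOne_optimal_orbit_sixteen_of_pal` (file 5 `NegOneOptimalTwistRigidityProof`, §22 of HOME/an/Sketch-an5v4.lean
487216973dab90e5) take the hypothesis schema `NegOneTwistMinimalDiscrEq`, whose statement is LITERALLY the Literature
fact; this file feeds the fact in, so that THEOREM I is CONDITIONAL on exactly one registered printed input (trust base:
`Literature.NumberTheory.EllipticCurves.connellPal_Δ_eq_of_negOne_twist_of_four_dvd_conductor`).  No `sorry`.
-/

noncomputable section

open scoped MatrixGroups ModularForm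

open CongruenceSubgroup WeierstrassCurve
  Literature.NumberTheory.DiophantineGeometry
  Literature.NumberTheory.EllipticCurves
  Literature.NumberTheory.EllipticCurves.ModularForms

namespace Summit.BirchSwinnertonDyer.Rank1Residual.ManinAdditive

/-- The Literature fact IS the hypothesis schema `NegOneTwistMinimalDiscrEq` (same statement).
[cite: Pal2012, Prop. 2.4 (Connell), case p = 2, d ≡ 3 (mod 4)] -/
theorem negOneTwistMinimalDiscrEq_of_connellPal
    (h : connellPal_Δ_eq_of_negOne_twist_of_four_dvd_conductor) : NegOneTwistMinimalDiscrEq :=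
  fun W W' _ _ _ _ u h4 h4' hu ↦ h W W' u h4 h4' hu

/-- **THEOREM I (E-an-10 `MinusOneOrbitManinEq`, leaf p558368) from the printed Connell–Pal lemma.**
[cite: Pal2012, Prop. 2.4 (Connell)] -/
theorem minusOneOrbitManinEq_of_connellPal
    (h : connellPal_Δ_eq_of_negOne_twist_of_four_dvd_conductor) : MinusOneOrbitManinEq :=
  minusOneOrbitManinEq_of_pal (negOneTwistMinimalDiscrEq_of_connellPal h)

/-- **E-an-8 (ii) `MinusOneTwistRigidity` (leaf p551258) from the printed Connell–Pal lemma.**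
[cite: Pal2012, Prop. 2.4 (Connell)] -/
theorem minusOneTwistRigidity_of_connellPal
    (h : connellPal_Δ_eq_of_negOne_twist_of_four_dvd_conductor) : MinusOneTwistRigidity :=
  minusOneTwistRigidity_of_pal (negOneTwistMinimalDiscrEq_of_connellPal h)

/-- **THEOREM I at `2⁴`** (rigidity ∧ `c′ = ±c` ∧ `deg′ = deg` on optimal same-level `χ₋₄`-orbits with `16 ∣ N`)
from the printed Connell–Pal lemma. [cite: Pal2012, Prop. 2.4 (Connell)] -/
theorem negOne_optimal_orbit_sixteen_of_connellPal
    (h : connellPal_Δ_eq_of_negOne_twist_of_four_dvd_conductor) :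
    ∀ (W W' : WeierstrassCurve ℚ) [W.IsElliptic] [W.IsGloballyMinimal] [W'.IsElliptic]
    [W'.IsGloballyMinimal] [NeZero (W.conductorNorm ℤ)] [NeZero (W'.conductorNorm ℤ)]
    (D : ModularParametrizationData W (W.conductorNorm ℤ))
    (D' : ModularParametrizationData W' (W'.conductorNorm ℤ)),
    IsLatticeOptimal D → IsLatticeOptimal D' →
    16 ∣ W.conductorNorm ℤ → W'.conductorNorm ℤ = W.conductorNorm ℤ →
    IsIsogenous (W.quadraticTwist ((-1 : ℤ) : ℚ)) W' →
    (∃ u : VariableChange ℚ, u • W.quadraticTwist ((-1 : ℤ) : ℚ) = W') ∧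
      (D'.c = D.c ∨ D'.c = -D.c) ∧ D'.modularDegree = D.modularDegree :=
  negOne_optimal_orbit_sixteen_of_pal (negOneTwistMinimalDiscrEq_of_connellPal h)

end Summit.BirchSwinnertonDyer.Rank1Residual.ManinAdditive

end
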